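import Summits.Ventures.Crystal3D.Theorems.StickyWulffConstantCoaxialWallLawReachCoreOfRows
import Summits.Ventures.Crystal3D.Theorems.StickyWulffConstantGenericWallFloorStarFarHolds
import Summits.Ventures.Crystal3D.Theorems.StickyWulffConstantTextureLiminfL12Local
import HarnessLib

/-!
# Lane F's debt with the kernel-certified inputs plugged: `CoaxialWallLaw` ⇐ {E1, the two census rows}
# (crux `CoaxialWallLaw`, stmt-Ventures-19481, line `WallLedgerF`; COMPUTATIONAL GRADE)

HONEST FRAMING. Venture `Summits/Ventures/Crystal3D` (cell `crystal3d-full`), helper `--supports` the crux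
`CoaxialWallLaw` of `route-Ventures-StickyWulffConstant` (REGISTERED line `WallLedgerF`).  LEAF book-keeping file;
F-C1 not moved; the crux stays OPEN modulo the named facts below.  Grade: COMPUTATIONAL — this file imports
`kissingGap_250 : KissingGap (5/2)` (`…TextureLiminfL12Local`, from the cell's cap census `CapX2.noHole_0625`),
`kissingClassification_250 : KissingClassification (5/2)` (`Kissing125.Classification`, the BIMODAL(1.25) census) and
`StarFar.starPairFar_holds : StarPairFar` (`…GenericWallFloorStarFarHolds`), all three standard axioms +
`Lean.ofReduceBool` through named `native_decide` evaluations of kernel-sound checkers.  With them the hypothesis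
list of `coaxialWallLaw_of_twoRows` (`…CoaxialWallLawReachCoreOfRows`, 19481-p2 g7, standard axioms) shrinks to

  **`CoaxialWallLaw` ⇐ { `P5Exhaustion` (E1: the C12-55 polar-cap exhaustion, cf-p2's certified computation, NOT in
  the kernel), `0 < s_F ≤ 2√6`, `EndRowTwinHalfTurn v1 s_F`, `EndRowTrans v1 s_F` (the two typed census rows of
  `…CoaxialWallLawEndRowDefs`, F STEP-3 certificate) }.**

* `coaxialTwoSlabAdhesion_of_twoRows_certified` (the registered
  stub keyed to `ExactOnly`), **`coaxialWallLaw_of_twoRows_certified`** (keyed to `P5Exhaustion`),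
  `coaxialWallLaw_of_twoRows_exactOnly_certified`.
WHAT THIS IS NOT: a proof of E1 or of either row; the standard-axiom statements with the four facts as named
hypotheses remain the ones in `…ReachCoreOfRows`; F-C1 not moved.
-/

noncomputable section

namespace Summit.Ventures.Crystal3D.Theorems

open Summit.Ventures.Crystal3D Finset
open Summit.Ventures.Crystal3D.Cruxes.CoaxialWallLaw.WallLedgerF (CoaxialTwoSlabAdhesion)
open scoped InnerProductSpace

section Certified

variable {sF : ℝ} (hsF : 0 < sF) (hsF' : sF ≤ 2 * Real.sqrt 6)
  (hrowW : EndRowTwinHalfTurn WordVersion.v1 sF) (hrowT : EndRowTrans WordVersion.v1 sF)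
include hsF hsF' hrowW hrowT

open scoped Classical in
/-- **The registered stub from `ExactOnly`(C12-55) and the two rows** (`StarPairFar` and the kissing facts plugged). -/
theorem coaxialTwoSlabAdhesion_of_twoRows_certified
    {s₀ : EuclideanSpace ℝ (Fin 3)} (hs₀ : s₀ ∈ fccSlots)
    (hcert : ExactOnly 0 (fccSlots.filter fun w => 0 < ⟪w, s₀⟫_ℝ)) : CoaxialTwoSlabAdhesion :=
  coaxialTwoSlabAdhesion_of_twoRows kissingGap_250 kissingClassification_250 hsF hsF' hrowW hrowT hs₀ hcert
    StarFar.starPairFar_holds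

open scoped Classical in
/-- **`CoaxialWallLaw` from `ExactOnly`(C12-55) and the two rows.** -/
theorem coaxialWallLaw_of_twoRows_exactOnly_certified
    {s₀ : EuclideanSpace ℝ (Fin 3)} (hs₀ : s₀ ∈ fccSlots)
    (hcert : ExactOnly 0 (fccSlots.filter fun w => 0 < ⟪w, s₀⟫_ℝ)) :
    Summit.Ventures.Crystal3D.Theses.StickyWulffConstant.CoaxialWallLaw :=
  coaxialWallLaw_of_twoRows kissingGap_250 kissingClassification_250 hsF hsF' hrowW hrowT hs₀ hcert
    StarFar.starPairFar_holds

/-- **`CoaxialWallLaw` ⇐ {`P5Exhaustion`, the two census rows}** — lane F's whole residual input list at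
computational grade. -/
theorem coaxialWallLaw_of_twoRows_certified (hE1 : P5Exhaustion) :
    Summit.Ventures.Crystal3D.Theses.StickyWulffConstant.CoaxialWallLaw :=
  coaxialWallLaw_of_twoRows_p5 kissingGap_250 kissingClassification_250 hsF hsF' hrowW hrowT hE1
    StarFar.starPairFar_holds

end Certified

end Summit.Ventures.Crystal3D.Theorems

end
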